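import Summits.BirchSwinnertonDyer.BirchSwinnertonDyer.Theorems.SignedLowerHalvesSmallImageMuZeroOneSignMuControl
import HarnessLib

/-!
# Route `SignedLowerHalves` (K3), crux M `SmallImageMuZeroOneSign` (item stmt-BirchSwinnertonDyer-23600): bookkeeping of the
# `μ`-resplit cone {L = 23599, M = 23600} — kernel certificates of two sentences of the route file / the vets
# (cell `bsd-ssimc`, LEAD seat `cruxlead-stmt-BirchSwinnertonDyer-23600` gen 0; helper file `--supports 23600`; THEOREMS ONLY,
# route-independent — the children's bodies are stated verbatim as hypotheses, no `Theses` import)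

HONEST FRAMING.  Nothing here proves L, M, crux 4 or BSD; everything is CONDITIONAL on the displayed hypotheses (the children's
bodies) and on published binders BY NAME (`hCK`, `h12`, `h5`, `h3`, `hmodP`).

* (a) `smallImageMuZeroOneSign_of_facts_of_muBothSigns` — sibling L's BOTH-signs analytic rider (line birth_acns v14's
  `stub_muBothSigns_ns`, VERBATIM as a hypothesis) implies M's body modulo print (`SmallImageMuControl` §2 at `ε₀ := 1`): the
  `μ`-content of the whole resplit cone is L's rider.
* (b) `hasUnitContent_kobayashiL_of_lower_of_mu` (per pair and sign) and `muAnOneSign_of_lowerBothSigns_of_muZeroOneSign`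
  (class-wide) — the route file's sentence «under child L, M implies the analytic one-sign unit content = old child 23117»: L's
  body ∧ M's body ∧ the period units ⟹ retired 23117's body at EVERY odd `p`.  With `SmallImageMuControl` §4 (M ⟸ print ∧ 23117)
  this makes M and 23117 EQUIVALENT modulo L and print.

References: [Kobayashi2003] Conjecture (p. 2), Thm. 1.2, (3.4)–(3.6), Thm. 6.2–6.3, 7.3; [Pollack2003] Thm. 5.6, Prop. 6.18, Conj. 6.3;
[GreenbergVatsal2000] p. 2 (2), §3 Rem. 3.4.  Tree: `Theorems/SignedLowerHalvesSmallImageMuZeroOneSignMuControl.lean` (p683375/p683745).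
-/

-- D-0017: single-problem summit, the namespace repeats the problem name by design.
set_option linter.dupNamespace false
set_option autoImplicit false

noncomputable section

open scoped Classical MatrixGroups ModularForm

open CongruenceSubgroup WeierstrassCurve Field
  Literature.NumberTheory.EllipticCurves Literature.NumberTheory.EllipticCurves.ModularForms
  Literature.NumberTheory.EllipticCurves.Rank1Residual
  Literature.NumberTheory.EllipticCurves.Kobayashi2003
  Literature.NumberTheory.EllipticCurves.GreenbergVatsal2000 ZpExtension
  Literature.NumberTheory.EllipticCurves.IwasawaAlgebra Literature.NumberTheory.EllipticCurves.Module
  Summit.BirchSwinnertonDyer.Rank1Residual.Supersingular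
  Summit.BirchSwinnertonDyer.Rank1Residual.X1.MuLambda
  Summit.BirchSwinnertonDyer.BirchSwinnertonDyer.Rank1Residual
  Summit.BirchSwinnertonDyer.BirchSwinnertonDyer.Theorems.SmallImageMuControl

namespace Summit.BirchSwinnertonDyer.BirchSwinnertonDyer.Theorems.SmallImageMuCone

/-- **(a) L's rider closes M modulo print.** If at every pair of the domain, for the conductor-level newform and EACH sign `ε`,
some `L₀` has Pollack's parity-`ε` congruences and a unit coefficient (= line birth_acns v14's `stub_muBothSigns_ns` VERBATIM as a
hypothesis), then M's body holds — GRANTED `hCK h12 h5 h3 hmodP`.  (Take `ε₀ := 1`; §2.)  So the `μ`-content of the whole resplit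
cone {L, M} of crux 4 is L's rider. [cite: Kobayashi2003, Thm. 1.2, Thm. 6.2–6.3, Thm. 7.3 (7.21)] [cite: Pollack2003, Conj. 6.3 (p. 548)] -/
theorem smallImageMuZeroOneSign_of_facts_of_muBothSigns
    (hCK : thm62_63_73_signedColemanKato_zeta) (h12 : thm12_signedSelmerDual_finite_torsion)
    (h5 : realPeriodRat_eq_unit_mul_plusPeriod) (h3 : realPeriodRat_eq_unit_mul_plusPeriod_three)
    (hmodP : nonempty_modularParametrizationData)
    (hboth : ∀ (W : WeierstrassCurve ℚ) [W.IsElliptic] [W.IsGloballyMinimal] (p : ℕ) [Fact p.Prime],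
      p ≠ 2 → ClassX7 W p → ¬ W.HasCM → W.frobeniusTrace p = 0 → ¬ Surj W p →
      ∀ [NeZero (W.conductorNorm ℤ)] (f : CuspForm (Gamma0 (W.conductorNorm ℤ)) 2),
      IsNewformOf W f → ∀ ε : ℤˣ, ∃ L₀ : IwasawaAlgebra p,
        IsSignedPAdicLFunction f p ε L₀ ∧ HasUnitContent L₀) :
    ∀ (W : WeierstrassCurve ℚ) [W.IsElliptic] [W.IsGloballyMinimal] (p : ℕ) [Fact p.Prime],
      p ≠ 2 → ClassX7 W p → ¬ W.HasCM → W.frobeniusTrace p = 0 → ¬ Surj W p →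
      ∃ ε : ℤˣ, ∀ (κ : ZpExtension ℚ p) (γ : absoluteGaloisGroup ℚ), κ.IsCyclotomic → κ.IsTopGenerator γ →
        IsCyclotomicVariable p γ → ∀ (D : SignedSelmerDualData W κ γ ε) (ξ : IwasawaAlgebra p),
          D.charIdeal = Ideal.span {ξ} → mu ξ = 0 := by
  intro W _ _ p _ hp hX hCM hap hs
  exact exists_sign_muZero_of_muAnOneSign_of_facts hCK h12 h5 h3 hmodP W p hp hX hCM hap hs
    (fun f hf ↦ ⟨1, hboth W p hp hX hCM hap hs f hf 1⟩)

section UnitContentOfLowerOfMu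

variable (W : WeierstrassCurve ℚ) [W.IsElliptic] [W.IsGloballyMinimal] (p : ℕ) [Fact p.Prime]

/-- **(b, per pair and sign) Lower half ∧ algebraic `μ^ε = 0` ⟹ `μ(L_p^ε) = 0`.**  At an odd good prime `p` with `a_p = 0`, fix a
sign `ε` with Kobayashi's Eisenstein half `KobayashiLowerDivisibility W p ε` and with `μ(ξ) = 0` for every characteristic power series
of every key-`γ` dual datum of `Sel^ε(E/ℚ_∞)`.  Then for every newform `f` of conductor level and every Pollack pair `(L⁺, L⁻)`,
Kobayashi's `L_p^ε` (`kobayashiL ε L⁺ L⁻`) has a unit coefficient.  Proof: the cyclotomic pair `(κ, γ)` exists (tree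
`exists_isCyclotomic_isTopGenerator_isCyclotomicVariable_holds`), a dual datum `D` exists (`nonempty_signedSelmerDualData`), the period
ratio `ϖ` exists and is a `p`-unit (`h5`/`h3`); lower gives `char X^ε = (g)`, `g = C(u)·L·h`, so `L ∣ g`; `μ(g) = 0` and `g ≠ 0`
(`charIdeal_ne_bot`) give unit content of `g`, hence of its divisor `L`.  GRANTED `h5 h3` only.
[cite: Kobayashi2003, Conjecture (Main Conjecture) (p. 2), (3.4)–(3.6) (p. 7)] [cite: GreenbergVatsal2000, p. 2 (2), §3 Remark 3.4] -/
theorem hasUnitContent_kobayashiL_of_lower_of_mu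
    (h5 : realPeriodRat_eq_unit_mul_plusPeriod) (h3 : realPeriodRat_eq_unit_mul_plusPeriod_three)
    (hp : p ≠ 2) (hgood : W.HasGoodReductionAtPrime p) (hap : W.frobeniusTrace p = 0) {ε : ℤˣ}
    (hlow : KobayashiLowerDivisibility W p ε)
    (hμ : ∀ (κ : ZpExtension ℚ p) (γ : absoluteGaloisGroup ℚ), κ.IsCyclotomic → κ.IsTopGenerator γ →
      IsCyclotomicVariable p γ → ∀ (D : SignedSelmerDualData W κ γ ε) (ξ : IwasawaAlgebra p),
        D.charIdeal = Ideal.span {ξ} → mu ξ = 0)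
    [NeZero (W.conductorNorm ℤ)] (f : CuspForm (Gamma0 (W.conductorNorm ℤ)) 2) (hf : IsNewformOf W f)
    {Lplus Lminus : IwasawaAlgebra p} (hPP : IsPollackPair f p Lplus Lminus) :
    HasUnitContent (kobayashiL ε Lplus Lminus) := by
  obtain ⟨κ, hκ, γ, hγ, hγ'⟩ := exists_isCyclotomic_isTopGenerator_isCyclotomicVariable_holds p
  obtain ⟨D⟩ := nonempty_signedSelmerDualData (K := ℚ) W (κ := κ) (ε := ε) hγ
  obtain ⟨ϖ, hϖ⟩ := exists_periodRatio h5 h3 hp hgood hap f hf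
  obtain ⟨g, h, hchar, hιg⟩ := hlow κ γ hκ hγ hγ' f hf ϖ hϖ Lplus Lminus hPP D
  set L := kobayashiL ε Lplus Lminus with hL_def
  -- the period ratio is a unit `u`, so `g = C u * (L * h)`
  have hirr : W.HasIrreducibleModPGaloisRep p :=
    hasIrreducibleModPGaloisRep_of_dvd_frobeniusTrace W p hp
      (W.not_dvd_minimalDiscriminantInt_of_hasGoodReductionAtPrime' p hgood) (by rw [hap]; exact dvd_zero _)
  have hvϖ : padicValRat p ϖ = 0 := padicValRat_periodRatio_eq_zero h5 h3 W p hp hgood hirr f hf ϖ hϖ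
  have hϖ0 : ϖ ≠ 0 := by
    intro h0
    rw [h0, Rat.cast_zero, zero_mul] at hϖ
    exact (IsNewform0.plusPeriod_pos_holds hf.1 hf.coeffField_eq_bot).ne' hϖ.symm
  obtain ⟨u, hu⟩ := exists_units_coe_eq_ratCast hϖ0 hvϖ
  obtain ⟨-, hιu⟩ := span_C_units_mul_eq u (L * h)
  have hgeq : g = PowerSeries.C (u : ℤ_[p]) * (L * h) :=
    iwasawaToPowerSeries_injective p (by rw [hιg, hιu, hu])
  -- `μ(g) = 0`, `g ≠ 0` ⟹ unit content of `g` ⟹ of its divisor `L`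
  have hg0 : g ≠ 0 := by
    intro h0
    apply charIdeal_ne_bot (IwasawaAlgebra p) D.X
    have : D.charIdeal = ⊥ := by rw [hchar, h0, Ideal.span_singleton_eq_bot]
    exact this
  have hμg : mu g = 0 := hμ κ γ hκ hγ hγ' D g hchar
  have hug : HasUnitContent g := Summit.BirchSwinnertonDyer.Rank1Residual.X11a.hasUnitContent_of_mu_eq_zero hg0 hμg
  have hdvd : L ∣ g := ⟨PowerSeries.C (u : ℤ_[p]) * h, by rw [hgeq]; ring⟩
  rw [hasUnitContent_iff_not_C_dvd] at hug ⊢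
  exact fun hpL ↦ hug (hpL.trans hdvd)

end UnitContentOfLowerOfMu

/-- **(b, class-wide) L ∧ M ∧ period units ⟹ the one-sign analytic unit content at EVERY odd `p`** — retired item
stmt-BirchSwinnertonDyer-23117 `SmallImageOneSignUnitContent` (which asks it only at `5 ≤ p`) a fortiori: if at every pair of the
domain Kobayashi's Eisenstein half holds for both signs (child L's body, 23599) and some sign has algebraic `μ^ε = 0` (child M's body,
23600), then for the conductor-level newform some sign `ε₀` has an `L₀` with Pollack's parity-`ε₀` congruences and a unit coefficient
(Pollack's pair exists, tree-proved).  With §4 this makes M and 23117 EQUIVALENT modulo L and print — the resplit's child M is the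
retired one-sign rider in algebraic dress.  GRANTED `h5 h3` only. [cite: Kobayashi2003, Conjecture (Main Conjecture) (p. 2)]
[cite: Pollack2003, Thm. 5.6, Prop. 6.18, Conj. 6.3] [cite: GreenbergVatsal2000, §3 Remark 3.4] -/
theorem muAnOneSign_of_lowerBothSigns_of_muZeroOneSign
    (h5 : realPeriodRat_eq_unit_mul_plusPeriod) (h3 : realPeriodRat_eq_unit_mul_plusPeriod_three)
    (hL : ∀ (W : WeierstrassCurve ℚ) [W.IsElliptic] [W.IsGloballyMinimal] (p : ℕ) [Fact p.Prime],
      p ≠ 2 → ClassX7 W p → ¬ W.HasCM → W.frobeniusTrace p = 0 → ¬ Surj W p →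
      ∀ ε : ℤˣ, KobayashiLowerDivisibility W p ε)
    (hM : ∀ (W : WeierstrassCurve ℚ) [W.IsElliptic] [W.IsGloballyMinimal] (p : ℕ) [Fact p.Prime],
      p ≠ 2 → ClassX7 W p → ¬ W.HasCM → W.frobeniusTrace p = 0 → ¬ Surj W p →
      ∃ ε : ℤˣ, ∀ (κ : ZpExtension ℚ p) (γ : absoluteGaloisGroup ℚ), κ.IsCyclotomic → κ.IsTopGenerator γ →
        IsCyclotomicVariable p γ → ∀ (D : SignedSelmerDualData W κ γ ε) (ξ : IwasawaAlgebra p),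
          D.charIdeal = Ideal.span {ξ} → mu ξ = 0) :
    ∀ (W : WeierstrassCurve ℚ) [W.IsElliptic] [W.IsGloballyMinimal] (p : ℕ) [Fact p.Prime],
      p ≠ 2 → ClassX7 W p → ¬ W.HasCM → W.frobeniusTrace p = 0 → ¬ Surj W p →
      ∀ [NeZero (W.conductorNorm ℤ)] (f : CuspForm (Gamma0 (W.conductorNorm ℤ)) 2),
      IsNewformOf W f → ∃ (ε₀ : ℤˣ) (L₀ : IwasawaAlgebra p),
        IsSignedPAdicLFunction f p ε₀ L₀ ∧ HasUnitContent L₀ := by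
  intro W _ _ p _ hp hX hCM hap hs _ f hf
  obtain ⟨ε, hμ⟩ := hM W p hp hX hCM hap hs
  obtain ⟨Lplus, Lminus, hPP⟩ :=
    exists_isPollackPair pollack_exists_plusMinusPAdicLFunction_holds hp hf hX.1.1 hap
  exact ⟨ε, kobayashiL ε Lplus Lminus, hPP.isSignedPAdicLFunction_kobayashiL ε,
    hasUnitContent_kobayashiL_of_lower_of_mu W p h5 h3 hp hX.1.1 hap (hL W p hp hX hCM hap hs ε) hμ f hf hPP⟩

end Summit.BirchSwinnertonDyer.BirchSwinnertonDyer.Theorems.SmallImageMuCone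

end
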